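import Summits.HodgeConjecture.HodgeConjecture.Theorems.F0P3HolFormArchIsotypy
import Summits.HodgeConjecture.HodgeConjecture.Theorems.F0P3HolFormKType
import Summits.HodgeConjecture.HodgeConjecture.Theorems.F0P3GenAdmissible
import HarnessLib

/-!
# Crux `H413` — RUNG 1½ «ISOTYPY FROM A NULL CORE»: THE HOLOMORPHIC HALF OF LETTER F1a AT THE CM PIN, PROVED
# (`P.ArchIsotypy (uFormGroup (Fin 2) (Fin 1)) (cmArchSectionUForm L ι H T hT)` for every `P` of Hodge type `(1,0)` at `ι`,
# `H` definite away from `ι`, `[L⁺:ℚ] ≥ 2`)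

Floor-0 programme P3 «U3-mult», seat F0P3-p02 (g3); crux item stmt-HodgeConjecture-24833 (`HCCMUnconditional.H413`); rung-1 line
`Cruxes/H413/Lines/F0_U3LettersRung1.lean`, stub `stub_F1a_cm : StubF1aCM` (letter F1a ★ `DiscreteAutomorphicRep.ArchIsotypy`); road
«F1a in-house at the pin» (`F0/P3/F0P3-p02/ROAD-F1a-inhouse.F0P3p02g3.md`).  HC_CM is proved only modulo the printed citations until rung 0 closes.

* **`archIsotypy_of_isHolCotangentAt`** — for `P.IsHolCotangentAt (cmArchSection …) (cmCompactFactor …)`: ★ B5c `archIsotypy_of_hol` (F0P3-p02) with its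
  two residual binders discharged — (a) the cotangent `K`-type is irreducible, ★ `F0P3HolFormKType.hEirr_cm` (F0P3-p03 (g4)); (b) `K` is admissible on
  `gen`, ★ `F0P3GenAdmissible.isAdmissibleGK_subrepresentation_of_le_gen` (F0P3-p03 (g4)), the weight `w = i` of the null core being read off ★
  `valueMap_hol` through ★ B5c `nullCore_of_valueMap`.
* **`holHalfF1aCM_cpt`** — the same ∀-closed over the CM datum in the binder order of the line's `StubF1aCM` with `hdef`, `h2` inserted after `hT`
  (REF1 (g2) interface point 2026-08-31T02:26:35Z): the `hhol` input of ★-pending B6 `F0P3ArchIsotypyConj.archIsotypy_cm_of_hol_half` (F0P3-p01 (g4)),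
  which supplies the antiholomorphic half by conjugation transport.

No definition, no sorry, no named fact; `--supports stmt-HodgeConjecture-24833 --as helper`.

References: [HarishChandra1953] Thms. 4–6, §9; [FlathCorvallis1979] Thm. 3–4; [BorelJacquetCorvallis1979] §4.3, §4.6; [BorelWallach2000] 0 §2.4–2.5,
II §4.1, VII 3.2; [Rogawski1990] Prop. 15.2.1 (b); [Dixmier1977] §13.1.2.
-/

set_option linter.dupNamespace false

-- Mathlib idiom (Mathlib/Algebra/Lie/OfAssociative.lean; as in ★ `F0P3HolFormArchIsotypy`): the commutator bracket on `Module.End ℂ V`.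
attribute [local instance 100] LieRing.ofAssociativeRing

open scoped Matrix MatrixGroups ComplexConjugate ENNReal ComplexOrder
open NumberField MeasureTheory

namespace Summit.HodgeConjecture.HodgeConjecture.Cruxes.H413.F0P3StubF1aHolHalf

open Literature.NumberTheory.Automorphic Literature.NumberTheory.Automorphic.UnitaryGroup
open Literature.NumberTheory.Automorphic.UnitaryGroup.CotangentForms
open Literature.RepresentationTheory.KonnoKonno2007 Literature.RepresentationTheory.KonnoKonno2007.RealDualPair
open Literature.RepresentationTheory.BorelWallach2000
open Literature.Geometry.ComplexHyperbolic.BallModel (U21 J)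
open Literature.AlgebraicGeometry.ShimuraVarieties.BallForms (u21Group liePMat)
open Summit.HodgeConjecture.HodgeConjecture.Cruxes.H413.F0P3CotangentFormL2Span
open Summit.HodgeConjecture.HodgeConjecture.Cruxes.H413.F0P3CotangentFormValueMap
open Summit.HodgeConjecture.HodgeConjecture.Cruxes.H413.F0P3ValueMapOfFrameVectors (exists_valueMap)
open Summit.HodgeConjecture.HodgeConjecture.Cruxes.H413.F0P3HolProjectionReduction (compactSpace_automorphicQuotient_cm)
open Summit.HodgeConjecture.HodgeConjecture.Cruxes.H413.F0P3bPNullGeneration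
open Summit.HodgeConjecture.HodgeConjecture.Cruxes.H413.F0P3HolFormArchIsotypy
open Summit.HodgeConjecture.HodgeConjecture.Cruxes.H413.F0P3HolFormKType (hEirr_cm)
open Summit.HodgeConjecture.HodgeConjecture.Cruxes.H413.F0P3GenAdmissible

variable {L : Type} [Field L] [NumberField L] [IsCMField L] (ι : L →+* ℂ) {H : Matrix (Fin 3) (Fin 3) L}
  (T : GL (Fin 3) ℂ) (hT : (T : Matrix (Fin 3) (Fin 3) ℂ)ᴴ * H.map ι * (T : Matrix (Fin 3) (Fin 3) ℂ) = J)

/-- **LETTER F1a AT THE CM PIN FOR A HOLOMORPHIC-TYPE `P`, PROVED**: `H` definite away from `ι`, `[L⁺:ℚ] ≥ 2`, `μ` automorphic, `P` discrete of Hodge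
type `(1,0)` at `ι` ⇒ `P.ArchIsotypy (uFormGroup (Fin 2) (Fin 1)) (cmArchSectionUForm L ι H T hT)` — ★ B5c `archIsotypy_of_hol` with (a) ★
`F0P3HolFormKType.hEirr_cm` and (b) ★ `isAdmissibleGK_subrepresentation_of_le_gen` (weight `i` from ★ `valueMap_hol` via ★ `nullCore_of_valueMap`).
[cite: HarishChandra1953, Thms. 4–6 and §9] [cite: FlathCorvallis1979, Thm. 3 and Thm. 4] [cite: BorelJacquetCorvallis1979, §4.3 and §4.6]
[cite: BorelWallach2000, 0 §2.4–2.5, II §4.1 and VII 3.2] [cite: Rogawski1990, Prop. 15.2.1 (b)] -/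
theorem archIsotypy_of_isHolCotangentAt
    (hdef : ∀ τ' : L →+* ℂ, InfinitePlace.mk τ' ≠ InfinitePlace.mk ι → (H.map τ').PosDef) (h2 : 2 ≤ Module.finrank ℚ ↥(maximalRealSubfield L))
    (μ : Measure (adelicGroupData (↥(maximalRealSubfield L)) L (IsCMField.complexConj L) 3 H).automorphicQuotient)
    [(adelicGroupData (↥(maximalRealSubfield L)) L (IsCMField.complexConj L) 3 H).IsAutomorphicMeasure μ]
    (P : DiscreteAutomorphicRep (adelicGroupData (↥(maximalRealSubfield L)) L (IsCMField.complexConj L) 3 H) μ)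
    (hP : P.IsHolCotangentAt (cmArchSection L ι H T hT) (cmCompactFactor L ι H T hT)) :
    P.ArchIsotypy (uFormGroup (Fin 2) (Fin 1)) (cmArchSectionUForm L ι H T hT) := by
  obtain ⟨Φ, hΦ, hΦ0, hPΦ⟩ := hP
  refine archIsotypy_of_hol ι T hT hdef h2 μ P hΦ hΦ0 hPΦ
    (hEirr_cm ι T hT hdef h2 μ P hΦ) fun v hv U hU hK => ?_
  -- (b): the weight `w = i` of the null core `span {v₀, v₁}`, then admissibility of `K` on `U = gen`
  haveI := compactSpace_automorphicQuotient_cm hdef h2 (L := L) (ι := ι) (H := H)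
  haveI : FiniteDimensional ℂ (Submodule.span ℂ (Set.range v)) := FiniteDimensional.span_of_finite ℂ (Set.finite_range v)
  have hv' : ∀ j : Fin 2, (((v j : P.archModuleCM ι T hT) : P.space.toSubmodule) : (adelicGroupData (↥(maximalRealSubfield L)) L (IsCMField.complexConj L) 3 H).L2 μ) =
      (memLp_toQuotFun_apply ι T hT (μ := μ) hΦ j).toLp (toQuotFun (adelicGroupData (↥(maximalRealSubfield L)) L (IsCMField.complexConj L) 3 H) fun x => Φ x j) :=
    fun j => by obtain ⟨hm, h⟩ := hv j; exact h
  obtain ⟨φ, hφ⟩ := exists_valueMap LinearMap.id v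
  have hφ' : ∀ Y : (uFormGroup (Fin 2) (Fin 1)).lie,
      φ Y = ∑ j : Fin 2, ((Y : Matrix (Fin 2 ⊕ Fin 1) (Fin 2 ⊕ Fin 1) ℂ) (Sum.inl j) (Sum.inr 0)) • v j := hφ
  obtain ⟨-, hK', hk, hwt, hN, -⟩ := valueMap_hol ι T hT P hΦ v hv' φ hφ'
  have hw := (nullCore_of_valueMap (ρK := P.archRepKCM ι T hT) (ρ𝔤 := P.archRepLieCM ι T hT) v φ hφ' hK' hk hwt hN).1
  exact isAdmissibleGK_subrepresentation_of_le_gen (P.isGKModule_archModuleCM ι T hT) Complex.I_mul_I hw hK hU.le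

/-- **THE HOLOMORPHIC HALF OF `StubF1aCM` (with `hdef`, `h2` after `hT`), ∀-closed over the CM datum** — the `hhol` input of ★ B6
`F0P3ArchIsotypyConj.archIsotypy_cm_of_hol_half` at each fixed `(L, ι, H, T, hT, μ)`. [cite: HarishChandra1953, Thms. 4–6 and §9]
[cite: FlathCorvallis1979, Thm. 3 and Thm. 4] [cite: BorelJacquetCorvallis1979, §4.3 and §4.6] -/
theorem holHalfF1aCM_cpt :
    ∀ (L : Type) [Field L] [NumberField L] [IsCMField L] (ι : L →+* ℂ) (H : Matrix (Fin 3) (Fin 3) L) (T : GL (Fin 3) ℂ)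
      (hT : (T : Matrix (Fin 3) (Fin 3) ℂ)ᴴ * H.map ι * (T : Matrix (Fin 3) (Fin 3) ℂ) = Literature.Geometry.ComplexHyperbolic.BallModel.J),
      (∀ τ' : L →+* ℂ, InfinitePlace.mk τ' ≠ InfinitePlace.mk ι → (H.map τ').PosDef) →
      2 ≤ Module.finrank ℚ ↥(maximalRealSubfield L) →
    ∀ (μ : Measure (adelicGroupData (↥(maximalRealSubfield L)) L (IsCMField.complexConj L) 3 H).automorphicQuotient)
      [(adelicGroupData (↥(maximalRealSubfield L)) L (IsCMField.complexConj L) 3 H).IsAutomorphicMeasure μ]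
      (P : DiscreteAutomorphicRep (adelicGroupData (↥(maximalRealSubfield L)) L (IsCMField.complexConj L) 3 H) μ),
      P.IsHolCotangentAt (cmArchSection L ι H T hT) (cmCompactFactor L ι H T hT) →
      P.ArchIsotypy (uFormGroup (Fin 2) (Fin 1)) (cmArchSectionUForm L ι H T hT) :=
  fun _L _ _ _ ι _H T hT hdef h2 μ _ P hP => archIsotypy_of_isHolCotangentAt ι T hT hdef h2 μ P hP

end Summit.HodgeConjecture.HodgeConjecture.Cruxes.H413.F0P3StubF1aHolHalf
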